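import Summits.QuantumFields.YangMills.Theorems.IR.StrongCouplingRateTail
import Literature.MathematicalPhysics.QuantumFieldTheory.Balaban1983to89.InfiniteVolumeSufficientXII
import Literature.MathematicalPhysics.QuantumFieldTheory.Balaban1983to89.MassGapFunctionalInequalities
import HarnessLib

/-!
# Crux `IR` (stmt-QuantumFields-19354), input (a) of the strong-coupling rungs: the volume-uniform cold pressure bound
# at the RATE `(1 + log(r_ρ/β))/8 → ∞` (`β → 0⁺`), from the rate-tracking Kotecký–Preiss tail

Helper module for item `stmt-QuantumFields-19354` (`--supports … --as helper`; it closes nothing).  Sequel of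
`Theorems/IR/StrongCouplingRateTail.lean`.  The tree books the strong-coupling transfer gap ∕ cold trace bound at the
β-INDEPENDENT rates `1/4` ∕ `1/8` (`Missing.coldFreeEnergyBound_of_strongCoupling`, `Missing.transferGap_of_strongCoupling`,
`ColdPressurePincer.coldPressureAt_strongCoupling`), because the cluster expansion is run with decay weight `d(Y) = #Y`.  With the
weight `τ·#Y` of the prequel (admissible iff `e^{1+τ}(2M_ρβ)(D+1)² ≤ 1/2`, i.e. `τ ≤ 1 + log(r_ρ/β)`, `r_ρ = strongCouplingRadius ρ`)
the SAME chain (module XII: tube rate ⇒ spectral squeeze ⇒ `log(1+X) ≤ …` ⇒ module XI's bridge ⇒ PART II's cold trace bound ⇒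
`ColdPressureBound`) gives, for every compact metrisable `G`, every continuous unitary `ρ`, every spatial torus and `0 < β ≤ r_ρ`:

* `coldFreeEnergyBound_strongCoupling_rate`: `ColdFreeEnergyBound ρ β N (τ/4) 144 0`;
* `transferGap_strongCoupling_rate`: every sub-dominant eigenvalue of the transfer matrix is `≤ e^{−τ/4} λ₀` — a volume-uniform
  lattice mass gap `≥ (1 + log(r_ρ/β))/4`, growing like `log(1/β)` (the printed leading behaviour `m(β) ≍ −log β`,
  Montvay–Münster (3.438), up to the coefficient);
* `coldPressureBound_strongCoupling_rate` ∕ `coldPressureBound_strongCoupling_log`: `ColdPressureBound r.ρ β S (τ/8) C₀` for EVERY `S`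
  with ONE absolute constant `C₀ = 28311552·e^{28311552}`, `τ = 1 + log(r_ρ/β)`.

This is «input (a)» of the line `tension-ratio` (card v1.6 note; rung T2-sc `RatioStrongCoupling` on `(0, β_D]`) and of LINE 1's MONO-sc
re-pricing: a `(0, β_D]`-uniform ratio constant `c` needs the cold-pressure rate to dominate `c·√(k log(1/β))`, which rate `1/8` cannot
and rate `≍ log(1/β)` does.  HONEST FRAMING: strong-coupling bookkeeping inside `IR`'s known regime (format rungs); the YM mass gap
(Clay) is NOT proved by any of this; R4 closes only the conditional finite-𝕋⁴ rung `BalabanLadder.UV`.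
Refs: K. Osterwalder, E. Seiler, Ann. Phys. 110 (1978) 440 §3; I. Montvay, G. Münster (1994) §3.4.4, §3.5; R. Kotecký, D. Preiss,
CMP 103 (1986) 491.
-/

set_option autoImplicit false

noncomputable section

open MeasureTheory Finset Filter Topology
open Literature.Probability.LatticeModels
open Literature.MathematicalPhysics.QuantumFieldTheory
open Literature.MathematicalPhysics.QuantumFieldTheory.Balaban1983to89
open Literature.MathematicalPhysics.QuantumFieldTheory.Balaban1983to89.Missing
open Literature.MathematicalPhysics.QuantumFieldTheory.Balaban1983to89.Sufficient (ColdTraceBound ColdPressureBound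
  coldPressureBound_of_coldTraceBound)

namespace Summit.QuantumFields.YangMills.Cruxes.IR.StrongCouplingRate

/-! ## §1 Scalar bookkeeping -/

/-- `t ≤ 3⌊t/2⌋` for `t ≥ 2`. -/
theorem le_three_mul_div_two {t : ℕ} (ht : 2 ≤ t) : t ≤ 3 * (t / 2) := by omega

/-- `t · e^{−τ t/12} ≤ 12` for `τ ≥ 1`, `t ≥ 0` (from `x e^{−x/4} ≤ 4` at `x = τt/3`). -/
theorem mul_exp_neg_rate_le (t : ℝ) (ht : 0 ≤ t) {τ : ℝ} (hτ : 1 ≤ τ) :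
    t * Real.exp (-(τ * t / 12)) ≤ 12 := by
  have h := mul_exp_neg_quarter_le (τ * t / 3)
  have he : Real.exp (-(1 / 4 * (τ * t / 3))) = Real.exp (-(τ * t / 12)) := by
    congr 1; ring
  rw [he] at h
  have hE : 0 ≤ Real.exp (-(τ * t / 12)) := (Real.exp_pos _).le
  have h1 : t * Real.exp (-(τ * t / 12)) ≤ τ * t * Real.exp (-(τ * t / 12)) := by
    have : t ≤ τ * t := by nlinarith
    exact mul_le_mul_of_nonneg_right this hE
  nlinarith

/-- **The tube truncation error at rate `τ` against the rate `τ/4`**: `12 a³ t e^{−τ⌊t/2⌋} ≤ 144 a³ e^{−(τ/4) t}` for `t ≥ 2`,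
`τ ≥ 1` (`⌊t/2⌋ ≥ t/3`, then `t e^{−τt/12} ≤ 12`). -/
theorem tube_error_le_rate (a : ℕ) {t : ℕ} (ht : 2 ≤ t) {τ : ℝ} (hτ : 1 ≤ τ) :
    12 * (a : ℝ) ^ 3 * t * Real.exp (-(τ * ((t / 2 : ℕ) : ℝ))) ≤
      144 * (a : ℝ) ^ 3 * Real.exp (-(τ / 4 * (t : ℝ))) := by
  have hτ0 : 0 ≤ τ := le_trans zero_le_one hτ
  have hfloor : (t : ℝ) ≤ 3 * ((t / 2 : ℕ) : ℝ) := by exact_mod_cast le_three_mul_div_two ht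
  have h1 : Real.exp (-(τ * ((t / 2 : ℕ) : ℝ))) ≤ Real.exp (-(τ * t / 3)) := by
    apply Real.exp_le_exp.2
    have : τ * (t : ℝ) ≤ τ * (3 * ((t / 2 : ℕ) : ℝ)) := mul_le_mul_of_nonneg_left hfloor hτ0
    linarith
  have hsplit : Real.exp (-(τ * t / 3)) = Real.exp (-(τ * t / 12)) * Real.exp (-(τ / 4 * (t : ℝ))) := by
    rw [← Real.exp_add]; congr 1; ring
  have h2 := mul_exp_neg_rate_le (t : ℝ) (Nat.cast_nonneg t) hτ
  have hE : 0 ≤ Real.exp (-(τ / 4 * (t : ℝ))) := (Real.exp_pos _).le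
  calc 12 * (a : ℝ) ^ 3 * t * Real.exp (-(τ * ((t / 2 : ℕ) : ℝ)))
      ≤ 12 * (a : ℝ) ^ 3 * t * Real.exp (-(τ * t / 3)) := mul_le_mul_of_nonneg_left h1 (by positivity)
    _ = 12 * (a : ℝ) ^ 3 * ((t : ℝ) * Real.exp (-(τ * t / 12))) * Real.exp (-(τ / 4 * (t : ℝ))) := by
        rw [hsplit]; ring
    _ ≤ 12 * (a : ℝ) ^ 3 * 12 * Real.exp (-(τ / 4 * (t : ℝ))) := by
        refine mul_le_mul_of_nonneg_right ?_ hE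
        exact mul_le_mul_of_nonneg_left h2 (by positivity)
    _ = 144 * (a : ℝ) ^ 3 * Real.exp (-(τ / 4 * (t : ℝ))) := by ring

/-- The rate-`τ` error is below the rate-`1` error (`τ ≥ 1`). -/
theorem exp_neg_rate_le_exp_neg {τ : ℝ} (hτ : 1 ≤ τ) (k : ℕ) :
    Real.exp (-(τ * (k : ℝ))) ≤ Real.exp (-(k : ℝ)) := by
  apply Real.exp_le_exp.2
  have : (0 : ℝ) ≤ k := Nat.cast_nonneg k
  nlinarith

/-! ## §2 Module XII's chain with the rate `τ` -/

section StrongCoupling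

variable {G : Type*} [Group G] [TopologicalSpace G] [IsTopologicalGroup G] [CompactSpace G]
  [MeasurableSpace G] [BorelSpace G] [SecondCountableTopology G] {n : ℕ} (ρ : G →* Matrix (Fin n) (Fin n) ℂ)

/-- **The strong-coupling expansion of the tube free energy with rate `τ`, real form**: for `0 ≤ β`, `β M_ρ ≤ 1`, `τ ≥ 1` with
`e^{1+τ}(2M_ρβ)(D+1)² ≤ 1/2` and every spatial period `N ≥ 1` there is a real tube rate `E_N(β)` with
`|log Z_β((T+2) × N³) − (T+2) E_N(β)| ≤ 12 N³ (T+2) e^{−τ⌊(T+2)/2⌋}` for every `T`.  Rate-tracking form of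
`Missing.exists_rate_abs_log_cyclicPartition_sub_le`. -/
theorem exists_rate_abs_log_cyclicPartition_sub_le_rate (hρ : Continuous ρ)
    (hρu : ∀ g, ρ g ∈ Matrix.unitaryGroup (Fin n) ℂ) {β τ : ℝ} (hβ0 : 0 ≤ β) (hτ : 1 ≤ τ)
    (hβM : β * costBound ρ ≤ 1)
    (hsmall : Real.exp (1 + τ) * (2 * costBound ρ * β) * ((boxDeg 4 : ℝ) + 1) ^ 2 ≤ 1 / 2) (N : ℕ) [NeZero N] :
    ∃ E : ℝ, ∀ T : ℕ, |Real.log (cyclicPartition ρ β N (T + 2)) - ((T : ℝ) + 2) * E| ≤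
      12 * (N : ℝ) ^ 3 * ((T : ℝ) + 2) * Real.exp (-(τ * ((((T + 2) / 2 : ℕ) : ℝ)))) := by
  have hM := costBound_pos ρ
  obtain ⟨e, he⟩ := exists_tube_rate_rate (G := G) hρ hτ hβM hsmall (a := N) (Nat.pos_of_ne_zero (NeZero.ne N))
  refine ⟨(e (β : ℂ)).re, fun T => ?_⟩
  have hzn : ‖(β : ℂ)‖ = β := by rw [Complex.norm_real, Real.norm_eq_abs, abs_of_nonneg hβ0]
  have hz : ‖(β : ℂ)‖ ≤ β := hzn.le
  have hzM : ‖(β : ℂ)‖ * costBound ρ ≤ 1 := by rw [hzn]; exact hβM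
  have hε : 0 ≤ 2 * costBound ρ * ‖(β : ℂ)‖ := by positivity
  have hz2 : Real.exp (1 + τ) * (2 * costBound ρ * ‖(β : ℂ)‖) * ((boxDeg 4 : ℝ) + 1) ^ 2 ≤ 1 / 2 := by
    rw [hzn]; exact hsmall
  have hz1 : Real.exp 1 * (2 * costBound ρ * ‖(β : ℂ)‖) * ((boxDeg 4 : ℝ) + 1) ^ 2 ≤ 1 / 2 :=
    PlaqSystem.smallness_one_of_two (D := boxDeg 4) hε (smallness_two_of_rate hε hτ hz2)
  have hR := boxSystem_regular (d := 4) (G := G) ρ hρ (![N, N, N, T + 2] : Fin 4 → ℕ)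
  have hZpos := cyclicPartition_pos_of_unitary ρ hρ hρu β N (T + 2)
  have h1 := he (T + 2) (by omega) (β : ℂ) hz
  have hre := PlaqSystem.re_pertLogZ_eq_log_norm_partZ hR hzM hz1 Finset.univ
  rw [partZ_boxSystem_ofReal_eq_cyclicPartition ρ hρ hρu β N (T + 2), Complex.norm_real, Real.norm_eq_abs,
    abs_of_pos hZpos] at hre
  set LZ : ℂ := pertLogZ (zdHaar 4 G) ((boxSystem (G := G) ρ (![N, N, N, T + 2] : Fin 4 → ℕ)).weight (β : ℂ))
      (boxSystem (G := G) ρ (![N, N, N, T + 2] : Fin 4 → ℕ)).Adj Finset.univ with hLZ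
  have hsub : (LZ - ((T + 2 : ℕ) : ℂ) * e (β : ℂ)).re =
      Real.log (cyclicPartition ρ β N (T + 2)) - ((T : ℝ) + 2) * (e (β : ℂ)).re := by
    rw [Complex.sub_re, hre, Complex.mul_re, Complex.natCast_re, Complex.natCast_im]
    push_cast
    ring
  rw [← hsub]
  refine (Complex.abs_re_le_norm _).trans (h1.trans (le_of_eq ?_))
  push_cast
  ring

/-- **The sharp form with rate `τ` — the tube rate is `log λ₀`**: under the same hypotheses,
`|log Z_β((T+2) × N³) − (T+2) log λ₀(β, N)| ≤ 12 N³ (T+2) e^{−τ⌊(T+2)/2⌋}` for every `T` (spectral squeeze + Archimedean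
squeeze, verbatim module XII).  Rate-tracking form of `Missing.abs_log_cyclicPartition_sub_mul_log_le`. -/
theorem abs_log_cyclicPartition_sub_mul_log_le_rate (hρ : Continuous ρ)
    (hρu : ∀ g, ρ g ∈ Matrix.unitaryGroup (Fin n) ℂ) {β τ : ℝ} (hβ0 : 0 ≤ β) (hτ : 1 ≤ τ)
    (hβM : β * costBound ρ ≤ 1)
    (hsmall : Real.exp (1 + τ) * (2 * costBound ρ * β) * ((boxDeg 4 : ℝ) + 1) ^ 2 ≤ 1 / 2) (N T : ℕ) [NeZero N] :
    |Real.log (cyclicPartition ρ β N (T + 2)) - ((T : ℝ) + 2) * Real.log (transferSpectralRadius ρ β N)| ≤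
      12 * (N : ℝ) ^ 3 * ((T : ℝ) + 2) * Real.exp (-(τ * ((((T + 2) / 2 : ℕ) : ℝ)))) := by
  obtain ⟨E, hE⟩ := exists_rate_abs_log_cyclicPartition_sub_le_rate ρ hρ hρu hβ0 hτ hβM hsmall N
  have hl := transferSpectralRadius_pos_of_unitary ρ hρ hρu hβ0 N
  have hZpos : ∀ m : ℕ, 0 < cyclicPartition ρ β N (m + 2) := fun m =>
    cyclicPartition_pos_of_unitary ρ hρ hρu β N (m + 2)
  set l : ℝ := Real.log (transferSpectralRadius ρ β N) with hl_def
  set B₀ : ℝ := 48 * Real.exp 1 * (N : ℝ) ^ 3 with hB₀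
  -- the truncation error is bounded uniformly in the period (compare with the rate-`1` error)
  have hB : ∀ m : ℕ, 12 * (N : ℝ) ^ 3 * ((m : ℝ) + 2) * Real.exp (-(τ * ((((m + 2) / 2 : ℕ) : ℝ)))) ≤ B₀ := by
    intro m
    have h := tube_error_le_quarter N (m + 2)
    push_cast at h
    have hle : Real.exp (-(1 / 4 * ((m : ℝ) + 2))) ≤ 1 :=
      Real.exp_le_one_iff.2 (by have : (0 : ℝ) ≤ m := Nat.cast_nonneg m; nlinarith)
    have hcmp : Real.exp (-(τ * ((((m + 2) / 2 : ℕ) : ℝ)))) ≤ Real.exp (-((((m + 2) / 2 : ℕ) : ℝ))) :=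
      exp_neg_rate_le_exp_neg hτ _
    calc 12 * (N : ℝ) ^ 3 * ((m : ℝ) + 2) * Real.exp (-(τ * ((((m + 2) / 2 : ℕ) : ℝ))))
        ≤ 12 * (N : ℝ) ^ 3 * ((m : ℝ) + 2) * Real.exp (-((((m + 2) / 2 : ℕ) : ℝ))) :=
          mul_le_mul_of_nonneg_left hcmp (by positivity)
      _ ≤ 48 * Real.exp 1 * (N : ℝ) ^ 3 * Real.exp (-(1 / 4 * ((m : ℝ) + 2))) := h
      _ ≤ 48 * Real.exp 1 * (N : ℝ) ^ 3 * 1 := by gcongr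
      _ = B₀ := by rw [hB₀, mul_one]
  -- logs of the spectral squeeze
  have hlow : ∀ m : ℕ, ((m : ℝ) + 2) * l ≤ Real.log (cyclicPartition ρ β N (m + 2)) := by
    intro m
    have h := Real.log_le_log (pow_pos hl (m + 2)) (pow_transferSpectralRadius_le_cyclicPartition ρ hρ hρu hβ0 N m)
    rw [Real.log_pow] at h
    push_cast at h
    exact h
  have hup : ∀ m : ℕ, Real.log (cyclicPartition ρ β N (m + 2)) ≤ (m : ℝ) * l + Real.log (cyclicPartition ρ β N 2) := by
    intro m
    have h := Real.log_le_log (hZpos m) (cyclicPartition_le_pow_mul ρ hρ hρu hβ0 N m)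
    rw [Real.log_mul (pow_pos hl m).ne' (hZpos 0).ne', Real.log_pow] at h
    exact h
  -- the rate is `log λ₀`
  have hE1 : E - l ≤ 0 := by
    refine nonpos_of_forall_add_two_mul_le (C := Real.log (cyclicPartition ρ β N 2) - 2 * l + B₀) fun m => ?_
    have h := (abs_le.1 ((hE m).trans (hB m))).1
    have h' := hup m
    nlinarith
  have hE2 : l - E ≤ 0 := by
    refine nonpos_of_forall_add_two_mul_le (C := B₀) fun m => ?_
    have h := (abs_le.1 ((hE m).trans (hB m))).2
    have h' := hlow m
    nlinarith
  have hEl : E = l := le_antisymm (by linarith) (by linarith)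
  rw [← hEl]
  exact hE T

/-- **`log(1 + X_{β,N}(T+2)) ≤ 12 N³ (T+2) e^{−τ⌊(T+2)/2⌋}`** — the thermal trace excess at rate `τ`, for ALL `N, T`. -/
theorem log_one_add_traceExcess_le_rate (hρ : Continuous ρ)
    (hρu : ∀ g, ρ g ∈ Matrix.unitaryGroup (Fin n) ℂ) {β τ : ℝ} (hβ0 : 0 ≤ β) (hτ : 1 ≤ τ)
    (hβM : β * costBound ρ ≤ 1)
    (hsmall : Real.exp (1 + τ) * (2 * costBound ρ * β) * ((boxDeg 4 : ℝ) + 1) ^ 2 ≤ 1 / 2) (N T : ℕ) [NeZero N] :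
    Real.log (1 + traceExcess ρ β N (T + 2)) ≤
      12 * (N : ℝ) ^ 3 * ((T : ℝ) + 2) * Real.exp (-(τ * ((((T + 2) / 2 : ℕ) : ℝ)))) := by
  have hl := transferSpectralRadius_pos_of_unitary ρ hρ hρu hβ0 N
  have hZ := cyclicPartition_pos_of_unitary ρ hρ hρu β N (T + 2)
  have h := (abs_le.1 (abs_log_cyclicPartition_sub_mul_log_le_rate ρ hρ hρu hβ0 hτ hβM hsmall N T)).2
  have hX : 1 + traceExcess ρ β N (T + 2) =
      cyclicPartition ρ β N (T + 2) / transferSpectralRadius ρ β N ^ (T + 2) := by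
    unfold traceExcess; ring
  rw [hX, Real.log_div hZ.ne' (pow_pos hl _).ne', Real.log_pow]
  push_cast
  linarith

/-- **S-T′ at strong coupling WITH RATE `τ/4`**: `ColdFreeEnergyBound ρ β N (τ/4) 144 0`, i.e.
`log(1 + X_{β,N}(T+2)) ≤ 144 · N³ · e^{−(τ/4)(T+2)}` for all `T`, on every spatial torus, whenever `0 ≤ β`, `β M_ρ ≤ 1`, `τ ≥ 1`
and `e^{1+τ}(2M_ρβ)(D+1)² ≤ 1/2`.  Rate-tracking form of `Missing.coldFreeEnergyBound_of_strongCoupling` (`τ = 1`: rate `1/4`). -/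
theorem coldFreeEnergyBound_strongCoupling_rate (hρ : Continuous ρ)
    (hρu : ∀ g, ρ g ∈ Matrix.unitaryGroup (Fin n) ℂ) {β τ : ℝ} (hβ0 : 0 ≤ β) (hτ : 1 ≤ τ)
    (hβM : β * costBound ρ ≤ 1)
    (hsmall : Real.exp (1 + τ) * (2 * costBound ρ * β) * ((boxDeg 4 : ℝ) + 1) ^ 2 ≤ 1 / 2) (N : ℕ) [NeZero N] :
    ColdFreeEnergyBound ρ β N (τ / 4) 144 0 := by
  intro T _
  have h := log_one_add_traceExcess_le_rate ρ hρ hρu hβ0 hτ hβM hsmall N T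
  have hq := tube_error_le_rate N (t := T + 2) (by omega) hτ
  push_cast at hq
  refine h.trans (hq.trans (le_of_eq ?_))
  ring

/-- **The volume-uniform transfer gap at rate `τ/4`**: every sub-dominant eigenvalue of `wilsonTorusTransferMatrix ρ β L` is
`≤ e^{−τ/4} λ₀`, for EVERY spatial period `L` — a lattice mass gap `≥ τ/4 = (1 + log(r_ρ/β))/4` growing like `log(1/β)`
(Osterwalder–Seiler 1978; the printed leading behaviour `m(β) ≍ −log β` up to the coefficient).  Rate-tracking form of
`Missing.transferGap_of_strongCoupling`. -/
theorem transferGap_strongCoupling_rate {L : ℕ} [NeZero L] (hρ : Continuous ρ)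
    (hρu : ∀ g, ρ g ∈ Matrix.unitaryGroup (Fin n) ℂ) {β τ : ℝ} (hβ0 : 0 ≤ β) (hτ : 1 ≤ τ)
    (hβM : β * costBound ρ ≤ 1)
    (hsmall : Real.exp (1 + τ) * (2 * costBound ρ * β) * ((boxDeg 4 : ℝ) + 1) ^ 2 ≤ 1 / 2) :
    ∃ (s : Set (Lp ℝ 2 (Measure.pi fun _ : Edge 3 L => haarProbability G))) (_ : Countable s)
      (b : HilbertBasis s ℝ (Lp ℝ 2 (Measure.pi fun _ : Edge 3 L => haarProbability G)))
      (lam : s → ℝ) (i₀ : s),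
      (∀ i, wilsonTorusTransferMatrix ρ β L (b i) = lam i • b i) ∧
      (∀ i, 0 ≤ lam i ∧ lam i ≤ lam i₀) ∧ 0 < lam i₀ ∧ transferSpectralRadius ρ β L = lam i₀ ∧
      ∀ i, i ≠ i₀ → lam i ≤ Real.exp (-(τ / 4)) * lam i₀ :=
  transferGap_of_coldFreeEnergyBound ρ hρ hρu hβ0 (by linarith) (by norm_num)
    (coldFreeEnergyBound_strongCoupling_rate ρ hρ hρu hβ0 hτ hβM hsmall L)

end StrongCoupling

/-! ## §3 The cold pressure bound at rate `τ/8` with ONE absolute constant (summit-side currency) -/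

section Rung

variable {G : Type} [Group G] [TopologicalSpace G] [IsTopologicalGroup G] [CompactSpace G]
  [MeasurableSpace G] [BorelSpace G] [SecondCountableTopology G]

/-- **Cold trace bound at rate `τ/8`, volume-free constant**: `ColdTraceBound r.ρ β S (τ/8) (A₀ e^{A₀})`, `A₀ = 28311552 = 3072·144·4³`,
for EVERY half-side `S` (module XI's bridge at `(m, K) = (τ/4, 144)`, constant monotone in `m ≥ 1/4`). -/
theorem coldTraceBound_strongCoupling_rate (r : LatticeRep G) {β τ : ℝ} (hβ0 : 0 ≤ β) (hτ : 1 ≤ τ)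
    (hβM : β * costBound r.ρ ≤ 1)
    (hsmall : Real.exp (1 + τ) * (2 * costBound r.ρ * β) * ((boxDeg 4 : ℝ) + 1) ^ 2 ≤ 1 / 2) (S : ℕ) :
    ColdTraceBound r.ρ β S (τ / 8) (28311552 * Real.exp 28311552) := by
  have hF : ColdFreeEnergyBound r.ρ β (2 * S + 1) (τ / 4) 144 0 :=
    coldFreeEnergyBound_strongCoupling_rate r.ρ r.continuous r.mem_unitary hβ0 hτ hβM hsmall (2 * S + 1)
  have hm : 0 < τ / 4 := by linarith
  have hT : ColdTraceBound r.ρ β S (τ / 4 / 2) (3072 * 144 / (τ / 4) ^ 3 * Real.exp (3072 * 144 / (τ / 4) ^ 3)) :=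
    coldTraceBound_of_coldFreeEnergyBound r.ρ hm (by norm_num) (by omega) hF
  have h8 : τ / 4 / 2 = τ / 8 := by ring
  rw [h8] at hT
  refine coldTraceBound_mono_const r.ρ hT ?_
  have hq : (1 / 4 : ℝ) ≤ τ / 4 := by linarith
  have hA : 3072 * 144 / (τ / 4) ^ 3 ≤ (28311552 : ℝ) := by
    have h1 : 3072 * 144 / (τ / 4) ^ 3 ≤ 3072 * 144 / (1 / 4 : ℝ) ^ 3 := by
      gcongr
    have h2 : 3072 * 144 / (1 / 4 : ℝ) ^ 3 = 28311552 := by norm_num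
    linarith
  have hA0 : 0 ≤ 3072 * 144 / (τ / 4) ^ 3 := by positivity
  exact mul_le_mul hA (Real.exp_le_exp.2 hA) (Real.exp_pos _).le (by norm_num)

/-- **Cold pressure bound at rate `τ/8` on EVERY spatial torus, ONE absolute constant**: for a lattice representation `r`,
`0 ≤ β`, `β M_ρ ≤ 1`, `τ ≥ 1` with `e^{1+τ}(2M_ρβ)(D+1)² ≤ 1/2`: `ColdPressureBound r.ρ β S (τ/8) (28311552 e^{28311552})` for all `S`. -/
theorem coldPressureBound_strongCoupling_rate (r : LatticeRep G) {β τ : ℝ} (hβ0 : 0 ≤ β) (hτ : 1 ≤ τ)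
    (hβM : β * costBound r.ρ ≤ 1)
    (hsmall : Real.exp (1 + τ) * (2 * costBound r.ρ * β) * ((boxDeg 4 : ℝ) + 1) ^ 2 ≤ 1 / 2) (S : ℕ) :
    ColdPressureBound r.ρ β S (τ / 8) (28311552 * Real.exp 28311552) := by
  have hT := coldTraceBound_strongCoupling_rate r hβ0 hτ hβM hsmall S
  have h := coldPressureBound_of_coldTraceBound hT (by positivity) (Nat.zero_le S)
  simpa using h

/-- **THE RATE-TRACKING STRONG-COUPLING COLD PRESSURE BOUND (input (a))**: for every lattice representation `r` of a compact
metrisable `G` and every `0 < β ≤ r_ρ = strongCouplingRadius r.ρ`, on EVERY spatial torus `(2S+1)³`,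
`ColdPressureBound r.ρ β S ((1 + log(r_ρ/β))/8) C₀` with the absolute constant `C₀ = 28311552 e^{28311552}` — the rate
`(1 + log(r_ρ/β))/8 ≥ 1/8` tends to `+∞` like `log(1/β)/8` as `β → 0⁺` (take `τ = 1 + log(r_ρ/β)`: then
`e^{1+τ}(2M_ρβ)(D+1)² = e²(2M_ρ r_ρ)(D+1)² ≤ 1/2` is the tree's `strongCouplingRadius_smallness`).  Compare
`ColdPressurePincer.coldPressureAt_strongCoupling` (rate `1/8`). -/
theorem coldPressureBound_strongCoupling_log (r : LatticeRep G) {β : ℝ} (hβ0 : 0 < β)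
    (hβ : β ≤ strongCouplingRadius r.ρ) (S : ℕ) :
    ColdPressureBound r.ρ β S ((1 + Real.log (strongCouplingRadius r.ρ / β)) / 8) (28311552 * Real.exp 28311552) := by
  have hr0 := strongCouplingRadius_pos r.ρ
  have hM := costBound_pos r.ρ
  have hq : 1 ≤ strongCouplingRadius r.ρ / β := by rw [le_div_iff₀ hβ0, one_mul]; exact hβ
  have hτ : 1 ≤ 1 + Real.log (strongCouplingRadius r.ρ / β) := by
    have := Real.log_nonneg hq
    linarith
  have hβM : β * costBound r.ρ ≤ 1 :=
    le_trans (mul_le_mul_of_nonneg_right hβ hM.le) (strongCouplingRadius_mul_costBound_le_one r.ρ)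
  have hexp : Real.exp (1 + (1 + Real.log (strongCouplingRadius r.ρ / β))) =
      Real.exp 2 * (strongCouplingRadius r.ρ / β) := by
    rw [show (1 : ℝ) + (1 + Real.log (strongCouplingRadius r.ρ / β)) = 2 + Real.log (strongCouplingRadius r.ρ / β) by ring,
      Real.exp_add, Real.exp_log (lt_of_lt_of_le one_pos hq)]
  have hsmall : Real.exp (1 + (1 + Real.log (strongCouplingRadius r.ρ / β))) * (2 * costBound r.ρ * β) *
      ((boxDeg 4 : ℝ) + 1) ^ 2 ≤ 1 / 2 := by
    rw [hexp]
    have heq : Real.exp 2 * (strongCouplingRadius r.ρ / β) * (2 * costBound r.ρ * β) =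
        Real.exp 2 * (2 * costBound r.ρ * strongCouplingRadius r.ρ) := by
      field_simp
    rw [heq]
    exact strongCouplingRadius_smallness r.ρ
  exact coldPressureBound_strongCoupling_rate r hβ0.le hτ hβM hsmall S

end Rung

end Summit.QuantumFields.YangMills.Cruxes.IR.StrongCouplingRate

end
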